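import Mathlib.Analysis.SpecialFunctions.Pow.Real
import HarnessLib

/-!
# Strassen preorders on commutative semirings: definitions (Zuiddam 2018, Ch. 2; Strassen 1988, §2)

Topic `Literature/Computability/AlgebraicComplexity`. This is the first file of the abstract theory
of *asymptotic spectra* (V. Strassen, *The asymptotic spectrum of tensors*, Crelle 384 (1988), §2;
exposition: J. Zuiddam, PhD thesis (2018), Chapter 2), developed here in order to PROVE the named fact
`strassen_duality_asymptoticRank` of `AsymptoticSpectrum.lean` (CVZ 2023, Prop. 1.6 = Strassen 1988,
Thm. 3.8: `R̃(t) = max_{ξ ∈ Δ} ξ(t)`). Everything in this file is a definition or a proved lemma.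

## Content (Zuiddam 2018, §2.2–2.4, §2.6, §2.8)

* `IsStrassenPreorder le` — Zuiddam Def. §2.3: a preorder `≼` on a commutative semiring `S ⊇ ℕ` with
  (1) `n ≼ m ↔ n ≤ m` on naturals, (2) `a ≼ b ⇒ a + c ≼ b + c, ac ≼ bc`, (3) `b ≠ 0 ⇒ ∃ r ∈ ℕ, a ≼ r b`.
  Basic consequences: `0 ≼ a`, sums/products/powers are monotone, `a ≼ r` for some `r ∈ ℕ`.
* `rankOf le a = R(a) = min {r ∈ ℕ : a ≼ r}` and `asympRankOf le a = R̃(a) = inf_N R(a^N)^{1/N}`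
  (Zuiddam §2.8), the latter literally in the shape of the tree's `asymptoticRank`
  (`⨅ N, R(a^{N+1})^{1/(N+1)}`).
* `IsSpectralPoint le φ` — a `≼`-monotone semiring homomorphism `φ : S → ℝ≥0` (Zuiddam Def. 2.8: the
  *asymptotic spectrum* `X(S, ≼)` is the set of these), with `φ n = n`, `φ ≥ 0`, `φ a ≤ R(a)`.
* `IsSubexponential f` (`∀ ε > 0, ∃ C, ∀ N, f N ≤ C (1+ε)^N`) and the **asymptotic preorder**
  `AsympLe le a b :⟺ ∃ f subexponential, ∀ N, a^N ≼ f(N) b^N` (Zuiddam Def. 2.1, with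
  `inf_N x_N^{1/N} = 1` phrased as subexponential growth, which is the same for sequences defined for
  every `N`).

The closure properties of `≼~` (Zuiddam Lemma 2.3/2.4), maximal and total extensions (§2.5), the
monotone homomorphism of a total Strassen preorder (Lemma 2.9) and the duality `R̃(a) = max_φ φ(a)`
(Cor. 2.13) are in the sibling files `StrassenPreorderClosure`, `StrassenPreorderMaximal`,
`StrassenPreorderHom`, `StrassenPreorderRank`.

## Design choices

* The preorder is an unbundled relation `le : S → S → Prop` on a Mathlib `CommSemiring S`, with the
  axioms bundled as the `Prop`-valued structure `IsStrassenPreorder le`; `ℕ ⊆ S` is `Nat.cast`. Axiom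
  (1) forces `CharZero`-like behaviour (`(n : S) = m → n = m`) and `(1 : S) ≠ 0`.
* `rankOf` is an `sInf` over `ℕ` (junk `0` on the empty set, which does not occur for Strassen
  preorders: `a ≼ r` for some `r`, `exists_le_natCast`).
* Spectral points are real-valued functions with the homomorphism and monotonicity properties as a
  `Prop` structure (rather than bundled `S →+* ℝ`), because Lemma 2.9 constructs them as bare functions;
  nonnegativity and `φ 0 = 0` are consequences.

## References

* J. Zuiddam, *Algebraic complexity, asymptotic spectra and entanglement polytopes*, PhD thesis,
  University of Amsterdam (2018), Chapter 2, §2.2–2.8 (pp. 19–28). [Zuiddam2018]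
* V. Strassen, *The asymptotic spectrum of tensors*, J. reine angew. Math. 384 (1988) 102–152, §2
  (Thm. 2.3, 2.4) and Thm. 3.8. [Strassen1988]
* M. Christandl, P. Vrana, J. Zuiddam, JAMS 36 (2023), Thm. 1.1 and Prop. 1.6. [ChristandlVranaZuiddam2023]

## Mathlib

No preordered-semiring / asymptotic-spectrum theory exists in Mathlib at the pin (searched
`StrassenPreorder`, `asymptotic spectrum`, `Positivstellensatz`, `preordered semiring`). Used:
`Nat.sInf_mem`, `Real.rpow_le_rpow`, `ciInf_le`.
-/

noncomputable section

open scoped BigOperators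

namespace Literature.Computability.AlgebraicComplexity

universe u

variable {S : Type u} [CommSemiring S]

/-! ## Strassen preorders -/

/-- A **Strassen preorder** on a commutative semiring `S` (Zuiddam 2018, §2.3; Strassen 1988, §2): a
reflexive, transitive relation `≼` such that (1) for naturals `n ≼ m ↔ n ≤ m`, (2) `a ≼ b` implies
`a + c ≼ b + c` and `a c ≼ b c`, and (3) for every `a` and every `b ≠ 0` there is `r ∈ ℕ` with `a ≼ r b`.
[cite: Zuiddam2018, §2.3] -/
structure IsStrassenPreorder (le : S → S → Prop) : Prop where
  /-- reflexivity -/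
  refl : ∀ a : S, le a a
  /-- transitivity -/
  trans : ∀ {a b c : S}, le a b → le b c → le a c
  /-- (1) on natural numbers `≼` is the usual order -/
  natCast_le_iff : ∀ n m : ℕ, le (n : S) (m : S) ↔ n ≤ m
  /-- (2) compatibility with addition -/
  add_right : ∀ {a b : S} (c : S), le a b → le (a + c) (b + c)
  /-- (2) compatibility with multiplication -/
  mul_right : ∀ {a b : S} (c : S), le a b → le (a * c) (b * c)
  /-- (3) the strong Archimedean axiom: `b ≠ 0 ⇒ ∃ r ∈ ℕ, a ≼ r b` -/
  exists_le_natCast_mul : ∀ (a : S) {b : S}, b ≠ 0 → ∃ r : ℕ, le a ((r : S) * b)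

namespace IsStrassenPreorder

variable {le : S → S → Prop}

/-- `c + a ≼ c + b` from `a ≼ b`. [cite: Zuiddam2018, §2.3] -/
theorem add_left (h : IsStrassenPreorder le) (c : S) {a b : S} (hab : le a b) :
    le (c + a) (c + b) := by
  rw [add_comm c a, add_comm c b]; exact h.add_right c hab

/-- `c a ≼ c b` from `a ≼ b`. [cite: Zuiddam2018, §2.3] -/
theorem mul_left (h : IsStrassenPreorder le) (c : S) {a b : S} (hab : le a b) :
    le (c * a) (c * b) := by
  rw [mul_comm c a, mul_comm c b]; exact h.mul_right c hab

/-- `a ≼ b, c ≼ d ⇒ a + c ≼ b + d` (Zuiddam §2.3, condition (2)). [cite: Zuiddam2018, §2.3] -/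
theorem add_le_add (h : IsStrassenPreorder le) {a b c d : S} (hab : le a b) (hcd : le c d) :
    le (a + c) (b + d) :=
  h.trans (h.add_right c hab) (h.add_left b hcd)

/-- `a ≼ b, c ≼ d ⇒ a c ≼ b d` (Zuiddam §2.3, condition (2)). [cite: Zuiddam2018, §2.3] -/
theorem mul_le_mul (h : IsStrassenPreorder le) {a b c d : S} (hab : le a b) (hcd : le c d) :
    le (a * c) (b * d) :=
  h.trans (h.mul_right c hab) (h.mul_left b hcd)

/-- `0 ≼ 1`. [cite: Zuiddam2018, §2.3] -/
theorem zero_le_one (h : IsStrassenPreorder le) : le (0 : S) 1 := by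
  have h01 := (h.natCast_le_iff 0 1).2 (Nat.zero_le 1)
  rwa [Nat.cast_zero, Nat.cast_one] at h01

/-- `0 ≼ a` for every `a` ("`0 ≼ 1` and multiply by `a`", Zuiddam §2.3). [cite: Zuiddam2018, §2.3] -/
theorem zero_le (h : IsStrassenPreorder le) (a : S) : le 0 a := by
  simpa using h.mul_right a h.zero_le_one

/-- `a ≼ a + b`. [cite: Zuiddam2018, §2.3] -/
theorem le_add_right (h : IsStrassenPreorder le) (a b : S) : le a (a + b) := by
  simpa using h.add_left a (h.zero_le b)

/-- `a ≼ b + a`. [cite: Zuiddam2018, §2.3] -/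
theorem le_add_left (h : IsStrassenPreorder le) (a b : S) : le a (b + a) := by
  simpa using h.add_right a (h.zero_le b)

/-- `1 ≠ 0` in a Strassen-preordered semiring. [cite: Zuiddam2018, §2.3] -/
theorem one_ne_zero (h : IsStrassenPreorder le) : (1 : S) ≠ 0 := by
  intro h10
  have h1 : le ((1 : ℕ) : S) ((0 : ℕ) : S) := by
    rw [Nat.cast_one, Nat.cast_zero, h10]; exact h.refl 0
  exact absurd ((h.natCast_le_iff 1 0).1 h1) (by omega)

/-- `Nat.cast` is injective. [cite: Zuiddam2018, §2.3] -/
theorem natCast_injective (h : IsStrassenPreorder le) : Function.Injective (Nat.cast : ℕ → S) := by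
  intro n m hnm
  have h1 : le (n : S) (m : S) := by rw [hnm]; exact h.refl _
  have h2 : le (m : S) (n : S) := by rw [hnm]; exact h.refl _
  exact le_antisymm ((h.natCast_le_iff n m).1 h1) ((h.natCast_le_iff m n).1 h2)

/-- Powers are monotone: `a ≼ b ⇒ a^n ≼ b^n`. [cite: Zuiddam2018, §2.3] -/
theorem pow_le_pow (h : IsStrassenPreorder le) {a b : S} (hab : le a b) (n : ℕ) :
    le (a ^ n) (b ^ n) := by
  induction n with
  | zero => simpa using h.refl 1
  | succ n ih => rw [pow_succ, pow_succ]; exact h.mul_le_mul ih hab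

/-- Finite sums are monotone. [cite: Zuiddam2018, §2.3] -/
theorem sum_le_sum (h : IsStrassenPreorder le) {ι : Type*} (s : Finset ι) {f g : ι → S}
    (hfg : ∀ i ∈ s, le (f i) (g i)) : le (∑ i ∈ s, f i) (∑ i ∈ s, g i) := by
  classical
  induction s using Finset.induction_on with
  | empty => simpa using h.refl 0
  | insert i s hi ih =>
    rw [Finset.sum_insert hi, Finset.sum_insert hi]
    exact h.add_le_add (hfg i (by simp)) (ih fun j hj => hfg j (by simp [hj]))

/-- Natural multiples are monotone in the natural number: `n ≤ m ⇒ n a ≼ m a`. [cite: Zuiddam2018, §2.3] -/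
theorem natCast_mul_le_natCast_mul (h : IsStrassenPreorder le) {n m : ℕ} (hnm : n ≤ m) (a : S) :
    le ((n : S) * a) ((m : S) * a) :=
  h.mul_right a ((h.natCast_le_iff n m).2 hnm)

/-- Every element is below some natural number: `∃ r, a ≼ r` (axiom (3) with `b = 1`). [cite: Zuiddam2018, §2.3] -/
theorem exists_le_natCast (h : IsStrassenPreorder le) (a : S) : ∃ r : ℕ, le a (r : S) := by
  obtain ⟨r, hr⟩ := h.exists_le_natCast_mul a h.one_ne_zero
  exact ⟨r, by simpa using hr⟩

/-- For `b ≠ 0` some natural multiple of `b` dominates `1`. [cite: Zuiddam2018, §2.3] -/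
theorem exists_one_le_natCast_mul (h : IsStrassenPreorder le) {b : S} (hb : b ≠ 0) :
    ∃ r : ℕ, le 1 ((r : S) * b) :=
  h.exists_le_natCast_mul 1 hb

/-- If `n ≼ a ≼ m` then `n ≤ m`. [cite: Zuiddam2018, §2.3] -/
theorem natCast_le_natCast_of_le (h : IsStrassenPreorder le) {n m : ℕ} {a : S} (hn : le (n : S) a)
    (hm : le a (m : S)) : n ≤ m :=
  (h.natCast_le_iff n m).1 (h.trans hn hm)

/-- An element dominating every natural number does not exist. [cite: Zuiddam2018, §2.3] -/
theorem not_forall_natCast_le (h : IsStrassenPreorder le) (a : S) : ¬ ∀ n : ℕ, le (n : S) a := by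
  intro hn
  obtain ⟨r, hr⟩ := h.exists_le_natCast a
  have := h.natCast_le_natCast_of_le (hn (r + 1)) hr
  omega

end IsStrassenPreorder

/-! ## Abstract rank and asymptotic rank -/

/-- The **rank** `R(a) = min {r ∈ ℕ : a ≼ r}` of an element of a preordered semiring (Zuiddam 2018,
§2.8). `sInf` over `ℕ`: junk value `0` if no natural number dominates `a` (impossible for a Strassen
preorder). [cite: Zuiddam2018, §2.8] -/
def rankOf (le : S → S → Prop) (a : S) : ℕ :=
  sInf {r : ℕ | le a (r : S)}

/-- The **asymptotic rank** `R̃(a) = inf_{N ≥ 1} R(a^N)^{1/N}` (Zuiddam 2018, §2.8, where it is the limit;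
limit = infimum by Fekete). Written as `⨅ N, R(a^{N+1})^{1/(N+1)}`, the shape of `asymptoticRank`. [cite: Zuiddam2018, §2.8] -/
def asympRankOf (le : S → S → Prop) (a : S) : ℝ :=
  ⨅ N : ℕ, ((rankOf le (a ^ (N + 1)) : ℝ) ^ ((N : ℝ) + 1)⁻¹)

namespace IsStrassenPreorder

variable {le : S → S → Prop}

/-- `a ≼ R(a)`. [cite: Zuiddam2018, §2.8] -/
theorem le_rankOf (h : IsStrassenPreorder le) (a : S) : le a (rankOf le a : S) :=
  Nat.sInf_mem (s := {r : ℕ | le a (r : S)}) (h.exists_le_natCast a)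

omit [CommSemiring S] in
/-- `a ≼ r ⇒ R(a) ≤ r`. [cite: Zuiddam2018, §2.8] -/
theorem rankOf_le_of_le [CommSemiring S] {le : S → S → Prop} {a : S} {r : ℕ} (har : le a (r : S)) :
    rankOf le a ≤ r :=
  Nat.sInf_le har

/-- `R(n) = n` for naturals. [cite: Zuiddam2018, §2.8] -/
theorem rankOf_natCast (h : IsStrassenPreorder le) (n : ℕ) : rankOf le (n : S) = n :=
  le_antisymm (rankOf_le_of_le (h.refl _)) ((h.natCast_le_iff _ _).1 (h.le_rankOf _))

/-- `R` is monotone. [cite: Zuiddam2018, §2.8] -/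
theorem rankOf_mono (h : IsStrassenPreorder le) {a b : S} (hab : le a b) : rankOf le a ≤ rankOf le b :=
  rankOf_le_of_le (h.trans hab (h.le_rankOf b))

/-- `R(ab) ≤ R(a) R(b)`. [cite: Zuiddam2018, §2.8] -/
theorem rankOf_mul_le (h : IsStrassenPreorder le) (a b : S) :
    rankOf le (a * b) ≤ rankOf le a * rankOf le b := by
  refine rankOf_le_of_le ?_
  rw [Nat.cast_mul]
  exact h.mul_le_mul (h.le_rankOf a) (h.le_rankOf b)

/-- `R(a^n) ≤ R(a)^n`. [cite: Zuiddam2018, §2.8] -/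
theorem rankOf_pow_le (h : IsStrassenPreorder le) (a : S) (n : ℕ) :
    rankOf le (a ^ n) ≤ rankOf le a ^ n := by
  induction n with
  | zero => rw [pow_zero, pow_zero, ← Nat.cast_one, h.rankOf_natCast]
  | succ n ih =>
    rw [pow_succ, pow_succ]
    exact (h.rankOf_mul_le _ _).trans (Nat.mul_le_mul_right _ ih)

/-- `R(n a) ≤ n R(a)`. [cite: Zuiddam2018, §2.8] -/
theorem rankOf_natCast_mul_le (h : IsStrassenPreorder le) (n : ℕ) (a : S) :
    rankOf le ((n : S) * a) ≤ n * rankOf le a := by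
  simpa [h.rankOf_natCast n] using h.rankOf_mul_le (n : S) a

/-- `R(a) = 0 ↔ a ≼ 0`. [cite: Zuiddam2018, §2.8] -/
theorem rankOf_eq_zero_iff (h : IsStrassenPreorder le) (a : S) : rankOf le a = 0 ↔ le a 0 := by
  constructor
  · intro h0
    have := h.le_rankOf a
    rwa [h0, Nat.cast_zero] at this
  · intro ha0
    exact Nat.le_zero.1 (rankOf_le_of_le (by simpa using ha0))

/-- `0 ≤ R̃(a)`. [cite: Zuiddam2018, §2.8] -/
theorem asympRankOf_nonneg (le : S → S → Prop) (a : S) : 0 ≤ asympRankOf le a :=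
  Real.iInf_nonneg fun N => by positivity

/-- `R̃(a) ≤ R(a^{N+1})^{1/(N+1)}` (each term of the infimum). [cite: Zuiddam2018, §2.8] -/
theorem asympRankOf_le (le : S → S → Prop) (a : S) (N : ℕ) :
    asympRankOf le a ≤ ((rankOf le (a ^ (N + 1)) : ℝ) ^ ((N : ℝ) + 1)⁻¹) := by
  unfold asympRankOf
  have hb : BddBelow (Set.range fun N : ℕ =>
      ((rankOf le (a ^ (N + 1)) : ℝ) ^ ((N : ℝ) + 1)⁻¹)) :=
    ⟨0, by rintro _ ⟨M, rfl⟩; positivity⟩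
  exact ciInf_le hb N

end IsStrassenPreorder

/-! ## Spectral points -/

/-- A **spectral point** of `(S, ≼)` (Zuiddam 2018, Def. 2.8; Strassen 1988, §2): a semiring
homomorphism `φ : S → ℝ≥0` (here real-valued; nonnegativity follows from monotonicity) that is
`≼`-monotone. The set of spectral points is the *asymptotic spectrum* `X(S, ≼)`. [cite: Zuiddam2018, Def. 2.8] -/
structure IsSpectralPoint (le : S → S → Prop) (φ : S → ℝ) : Prop where
  /-- `φ(1) = 1` -/
  map_one : φ 1 = 1
  /-- additivity -/
  map_add : ∀ a b : S, φ (a + b) = φ a + φ b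
  /-- multiplicativity -/
  map_mul : ∀ a b : S, φ (a * b) = φ a * φ b
  /-- monotonicity under `≼` -/
  mono : ∀ {a b : S}, le a b → φ a ≤ φ b

namespace IsSpectralPoint

variable {le : S → S → Prop} {φ : S → ℝ}

omit [CommSemiring S] in
/-- `φ(0) = 0`. [cite: Zuiddam2018, Def. 2.8] -/
theorem map_zero [CommSemiring S] {le : S → S → Prop} {φ : S → ℝ} (hφ : IsSpectralPoint le φ) :
    φ 0 = 0 := by
  have := hφ.map_add 0 0
  rw [add_zero] at this
  linarith

/-- `φ(n) = n`. [cite: Zuiddam2018, Def. 2.8] -/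
theorem map_natCast (hφ : IsSpectralPoint le φ) (n : ℕ) : φ (n : S) = n := by
  induction n with
  | zero => simp [hφ.map_zero]
  | succ n ih => rw [Nat.cast_succ, hφ.map_add, ih, hφ.map_one]; push_cast; ring

/-- `φ(a^n) = φ(a)^n`. [cite: Zuiddam2018, Def. 2.8] -/
theorem map_pow (hφ : IsSpectralPoint le φ) (a : S) (n : ℕ) : φ (a ^ n) = φ a ^ n := by
  induction n with
  | zero => simp [hφ.map_one]
  | succ n ih => rw [pow_succ, hφ.map_mul, ih, pow_succ]

/-- `φ(∑ f) = ∑ φ(f)`. [cite: Zuiddam2018, Def. 2.8] -/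
theorem map_sum (hφ : IsSpectralPoint le φ) {ι : Type*} (s : Finset ι) (f : ι → S) :
    φ (∑ i ∈ s, f i) = ∑ i ∈ s, φ (f i) := by
  classical
  induction s using Finset.induction_on with
  | empty => simp [hφ.map_zero]
  | insert i s hi ih => rw [Finset.sum_insert hi, Finset.sum_insert hi, hφ.map_add, ih]

/-- `φ ≥ 0` (from `0 ≼ a`). [cite: Zuiddam2018, Def. 2.8] -/
theorem nonneg (hφ : IsSpectralPoint le φ) (h : IsStrassenPreorder le) (a : S) : 0 ≤ φ a := by
  simpa [hφ.map_zero] using hφ.mono (h.zero_le a)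

/-- `φ(a) ≤ R(a)`. [cite: Zuiddam2018, §2.8] -/
theorem le_rankOf (hφ : IsSpectralPoint le φ) (h : IsStrassenPreorder le) (a : S) :
    φ a ≤ rankOf le a := by
  simpa [hφ.map_natCast] using hφ.mono (h.le_rankOf a)

/-- `φ(a) ≤ R̃(a)`: a spectral point is a lower bound for the asymptotic rank (the easy half of
Zuiddam Cor. 2.13: `R(a^N) ≥ φ(a)^N`). [cite: Zuiddam2018, Cor. 2.13] -/
theorem le_asympRankOf (hφ : IsSpectralPoint le φ) (h : IsStrassenPreorder le) (a : S) :
    φ a ≤ asympRankOf le a := by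
  refine le_ciInf fun N => ?_
  have h0 : 0 ≤ φ a := hφ.nonneg h a
  have hpow : φ a ^ ((N : ℝ) + 1) ≤ (rankOf le (a ^ (N + 1)) : ℝ) := by
    have : φ a ^ ((N : ℝ) + 1) = φ a ^ (N + 1) := by
      rw [← Real.rpow_natCast]; push_cast; ring_nf
    rw [this, ← hφ.map_pow]
    exact hφ.le_rankOf h _
  have hN : (0 : ℝ) < (N : ℝ) + 1 := by positivity
  calc φ a = (φ a ^ ((N : ℝ) + 1)) ^ ((N : ℝ) + 1)⁻¹ := by
        rw [← Real.rpow_mul h0, mul_inv_cancel₀ hN.ne', Real.rpow_one]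
    _ ≤ ((rankOf le (a ^ (N + 1)) : ℝ) ^ ((N : ℝ) + 1)⁻¹) :=
        Real.rpow_le_rpow (by positivity) hpow (by positivity)

end IsSpectralPoint

/-! ## Subexponential sequences and the asymptotic preorder (definitions) -/

/-- `f : ℕ → ℕ` is **subexponential**: for every `ε > 0`, `f(N) ≤ C_ε (1+ε)^N` for all `N`
(equivalently `f(N)^{1/N} → 1` along `f ≥ 1`; Zuiddam Def. 2.1 asks `inf_N x_N^{1/N} = 1`). [cite: Zuiddam2018, Def. 2.1] -/
def IsSubexponential (f : ℕ → ℕ) : Prop :=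
  ∀ ε : ℝ, 0 < ε → ∃ C : ℝ, ∀ N : ℕ, (f N : ℝ) ≤ C * (1 + ε) ^ N

/-- The **asymptotic preorder** `a ≼~ b` of a relation `≼` (Zuiddam 2018, Def. 2.1): there is a
subexponential `f : ℕ → ℕ` with `a^N ≼ f(N) · b^N` for all `N ∈ ℕ`. [cite: Zuiddam2018, Def. 2.1] -/
def AsympLe (le : S → S → Prop) (a b : S) : Prop :=
  ∃ f : ℕ → ℕ, IsSubexponential f ∧ ∀ N : ℕ, le (a ^ N) ((f N : S) * b ^ N)


end Literature.Computability.AlgebraicComplexity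

end
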